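import Mathlib

/-!
# `BalabanUV.Beta.FP.ScaleSeriesBounds` — road «FP» (d1-p3) for binder row D1, N7 PLAN v1 §2 (MS-3)∕(MS-4): THE SCALAR CORES OF THE SCALE SERIES
# (window tail `Σ_{k ≥ m} L^{−ak}` and the multiscale exponential tail `Σ_{k < m} L^{−ak} e^{−δt∕L^k}`) — pure real analysis, Mathlib only, no road object

HONEST FRAMING (cell contract, verbatim): «discharging `BetaPertH` makes Bałaban's UV stability UNCONDITIONAL — a real constructive-QFT
result; it is NOT the continuum limit and NOT the Clay problem.»  THIS MODULE DISCHARGES NOTHING: it is the elementary summation bookkeeping that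
the N7 plan (`HOME/b2b-balaban-beta-d1-p3/N7-PROOF.v1.md` §2) invokes in words — «summation of a geometric series of graded kernels» (MS-3) and
«m-uniform by summability of `t^{2+j}e^{−δt∕2}` over geometric sequences» (MS-4) — with EXPLICIT constants, for abstract reals `L > 1`, `δ > 0`, `t > 0`
and exponents `a : ℕ`.  READING (header only, never a hypothesis): `L = Lc`, `n = L^m` the blocking, `t = ‖w‖` (or `r + 1`), `a = 2 + j` the leg degree,
the `k`-th term = the scale-`L^k` contribution `H_{L^k} C^{[L^k]} H_{L^k}ᵀ` of the stationary telescoping (MS-1) after its graded bound (MS-2).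
CONTENT:
* §1 [folklore] `pow_mul_exp_neg_mul_le`: `x^n · e^{−δx} ≤ n! ∕ δ^n` (`x ≥ 0`, `δ > 0`; Mathlib `Real.pow_div_factorial_le_exp`).
* §2 [our object] **`sum_range_scale_tail_le`** (MS-4 core): for `L > 1`, `δ > 0`, `t > 0`, all `a m`,
  `Σ_{k<m} (L^k)^{−a} e^{−δt∕L^k} ≤ ((a+1)! ∕ (δ(1 − L⁻¹))^{a+1} ∕ (L − 1)) · (L^m ∕ t) · t^{−a} · e^{−δt∕L^m}`
  — PROOF: for `k < m`, `δt∕L^k ≥ δt∕L^m + δ(1 − L⁻¹)·(t∕L^k)`, then `x^{a+1}e^{−δ'x} ≤ (a+1)!∕δ'^{a+1}` at `x = t∕L^k` and the geometric sum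
  `Σ_{k<m} L^k ≤ L^m∕(L−1)`.  Corollary **`sum_range_scale_tail_le_of_le`**: on `L^m ≤ c·t` (beyond the window, `n ≤ cc·M n ≤ cc·t`) the bound is
  `c · (same constant) · t^{−a} · e^{−δt∕L^m}` — the `e^{−(δ∕n)t} ∕ t^a` shape of the END's tail rows `hFtail/hGtail` with an `m`-FREE amplitude.
* §3 [our object] **`tsum_scale_window_le`** (MS-3 core): for `L > 1`, `1 ≤ a`, a real sequence with `|u k| ≤ A·(L^k)^{−a}` for all `k` is summable on
  every tail and `|Σ_{i} u (m + i)| ≤ (A ∕ (1 − (L^a)⁻¹)) · (L^m)^{−a}` — the `D ∕ n^a` shape of the END's window rows `hF/hG`, amplitude `m`-FREE.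
NOT «D1 closed», NOT BetaPertH, NOT continuum, NOT Clay.  [our object] ∕ [folklore], Mathlib only, 0 `def`, 0 cite, 0 sorry.
HONEST DEPENDENCY (verbatim): «continuum YM on T⁴ ⇐ BetaPertH ∧ nine spine estimates (0/9 proved); BetaPertH ⇐ (D1) ∧ (D4) ∧ CAP+tail;
G-an2-4 gates asym, D1 and NE2/3/4.»
Provenance: b2b-balaban-gan24-formalise-leaf-02 gen 33 (idle G-an2-4 swarm leaf seat, cross-lane for road FP), 2026-08-20 (claim table `LEAVES-FP.md`
row N7/MS-3+4, sub-row MS-34-SUMS).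
-/

namespace Summit.QuantumFields.BalabanUV.Beta.FP.ScaleSeriesBounds

open Finset Real

/-! ## §1 One-variable bound -/

/-- [folklore] `x^n · e^{−δx} ≤ n! ∕ δ^n` for `x ≥ 0`, `δ > 0`. -/
theorem pow_mul_exp_neg_mul_le {δ : ℝ} (hδ : 0 < δ) {x : ℝ} (hx : 0 ≤ x) (n : ℕ) :
    x ^ n * exp (-(δ * x)) ≤ n.factorial / δ ^ n := by
  have key : (δ * x) ^ n ≤ n.factorial * exp (δ * x) := by
    have h := Real.pow_div_factorial_le_exp (δ * x) (by positivity) n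
    rwa [div_le_iff₀' (by positivity)] at h
  have hδn : 0 < δ ^ n := pow_pos hδ n
  calc x ^ n * exp (-(δ * x)) = ((δ * x) ^ n * exp (-(δ * x))) / δ ^ n := by
        rw [mul_pow]; field_simp
    _ ≤ n.factorial / δ ^ n := by
        gcongr
        rw [Real.exp_neg, ← div_eq_mul_inv, div_le_iff₀ (exp_pos _)]
        exact key

/-! ## §2 MS-4 core: the multiscale exponential tail -/

/-- [our object] **MS-4 CORE.**  For `L > 1`, `δ > 0`, `t > 0` and all `a m : ℕ`:
`Σ_{k<m} (L^k)^{−a} e^{−δt∕L^k} ≤ ((a+1)! ∕ (δ(1 − L⁻¹))^{a+1} ∕ (L − 1)) · (L^m ∕ t) · (t^{−a} · e^{−δt∕L^m})`. -/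
theorem sum_range_scale_tail_le {L δ t : ℝ} (hL : 1 < L) (hδ : 0 < δ) (ht : 0 < t) (a m : ℕ) :
    ∑ k ∈ range m, ((L ^ k) ^ a)⁻¹ * exp (-(δ * t / L ^ k))
      ≤ ((a + 1).factorial / (δ * (1 - L⁻¹)) ^ (a + 1) / (L - 1)) * (L ^ m / t)
          * ((t ^ a)⁻¹ * exp (-(δ * t / L ^ m))) := by
  have hL0 : 0 < L := by linarith
  have hL1 : 0 < L - 1 := by linarith
  have hLinv : 0 < 1 - L⁻¹ := by rw [sub_pos]; exact inv_lt_one_of_one_lt₀ hL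
  set δ' : ℝ := δ * (1 - L⁻¹) with hδ'
  have hδ'0 : 0 < δ' := mul_pos hδ hLinv
  set K : ℝ := (a + 1).factorial / δ' ^ (a + 1) with hK
  have hK0 : 0 ≤ K := by positivity
  set E : ℝ := (t ^ a)⁻¹ * exp (-(δ * t / L ^ m)) with hE
  have hE0 : 0 ≤ E := by positivity
  -- termwise bound
  have hterm : ∀ k ∈ range m, ((L ^ k) ^ a)⁻¹ * exp (-(δ * t / L ^ k)) ≤ K * E * (L ^ k / t) := by
    intro k hk
    rw [mem_range] at hk
    have hLk : 0 < L ^ k := pow_pos hL0 k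
    have hLm : 0 < L ^ m := pow_pos hL0 m
    set x : ℝ := t / L ^ k with hx
    have hx0 : 0 < x := div_pos ht hLk
    have e1 : ((L ^ k) ^ a)⁻¹ = x ^ a * (t ^ a)⁻¹ := by
      rw [hx, div_pow]; field_simp
    have hkm : L ^ k * L ≤ L ^ m := by
      rw [← pow_succ]; exact pow_le_pow_right₀ hL.le hk
    have e2 : δ * t / L ^ m + δ' * x ≤ δ * t / L ^ k := by
      have h1 : δ * t / L ^ m ≤ δ * t / (L ^ k * L) :=
        div_le_div_of_nonneg_left (by positivity) (by positivity) hkm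
      calc δ * t / L ^ m + δ' * x ≤ δ * t / (L ^ k * L) + δ' * x := by gcongr
        _ = δ * t / L ^ k := by rw [hδ', hx]; field_simp; ring
    have e3 : x ^ a * exp (-(δ' * x)) ≤ K * x⁻¹ := by
      rw [le_mul_inv_iff₀ hx0, hK]
      calc x ^ a * exp (-(δ' * x)) * x = x ^ (a + 1) * exp (-(δ' * x)) := by ring
        _ ≤ (a + 1).factorial / δ' ^ (a + 1) := pow_mul_exp_neg_mul_le hδ'0 hx0.le (a + 1)
    calc ((L ^ k) ^ a)⁻¹ * exp (-(δ * t / L ^ k))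
        ≤ (x ^ a * (t ^ a)⁻¹) * exp (-(δ * t / L ^ m + δ' * x)) := by
          rw [e1]
          gcongr
      _ = E * (x ^ a * exp (-(δ' * x))) := by
          rw [hE, neg_add, Real.exp_add]; ring
      _ ≤ E * (K * x⁻¹) := by gcongr
      _ = K * E * (L ^ k / t) := by rw [hx, inv_div]; ring
  -- the geometric sum of the scales
  have hgeom : ∑ k ∈ range m, L ^ k ≤ L ^ m / (L - 1) := by
    rw [geom_sum_eq hL.ne', div_le_div_iff_of_pos_right hL1]
    linarith
  calc ∑ k ∈ range m, ((L ^ k) ^ a)⁻¹ * exp (-(δ * t / L ^ k))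
      ≤ ∑ k ∈ range m, K * E * (L ^ k / t) := sum_le_sum hterm
    _ = K * E * ((∑ k ∈ range m, L ^ k) / t) := by rw [← mul_sum, sum_div]
    _ ≤ K * E * ((L ^ m / (L - 1)) / t) := by gcongr
    _ = (K / (L - 1)) * (L ^ m / t) * E := by
        field_simp
    _ = ((a + 1).factorial / (δ * (1 - L⁻¹)) ^ (a + 1) / (L - 1)) * (L ^ m / t) * E := by
        rw [hK, hδ']

/-- [our object] **MS-4 CORE BEYOND THE WINDOW**: if moreover `L^m ≤ c·t` (the END's tails start at `r ≥ M n` with `n ≤ cc·M n`), then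
`Σ_{k<m} (L^k)^{−a} e^{−δt∕L^k} ≤ c · ((a+1)! ∕ (δ(1 − L⁻¹))^{a+1} ∕ (L − 1)) · t^{−a} · e^{−δt∕L^m}` — an `m`-FREE amplitude times the END's tail profile
`e^{−(δ∕n)t} ∕ t^a`, `n = L^m`. -/
theorem sum_range_scale_tail_le_of_le {L δ t c : ℝ} (hL : 1 < L) (hδ : 0 < δ) (ht : 0 < t) (a m : ℕ) (hc : L ^ m ≤ c * t) :
    ∑ k ∈ range m, ((L ^ k) ^ a)⁻¹ * exp (-(δ * t / L ^ k))
      ≤ c * ((a + 1).factorial / (δ * (1 - L⁻¹)) ^ (a + 1) / (L - 1)) * ((t ^ a)⁻¹ * exp (-(δ * t / L ^ m))) := by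
  have hL1 : 0 < L - 1 := by linarith
  have hLinv : 0 < 1 - L⁻¹ := by rw [sub_pos]; exact inv_lt_one_of_one_lt₀ hL
  have hct : L ^ m / t ≤ c := by rwa [div_le_iff₀ ht]
  have hK0 : 0 ≤ (a + 1).factorial / (δ * (1 - L⁻¹)) ^ (a + 1) / (L - 1) := by positivity
  calc ∑ k ∈ range m, ((L ^ k) ^ a)⁻¹ * exp (-(δ * t / L ^ k))
      ≤ ((a + 1).factorial / (δ * (1 - L⁻¹)) ^ (a + 1) / (L - 1)) * (L ^ m / t)
          * ((t ^ a)⁻¹ * exp (-(δ * t / L ^ m))) := sum_range_scale_tail_le hL hδ ht a m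
    _ ≤ ((a + 1).factorial / (δ * (1 - L⁻¹)) ^ (a + 1) / (L - 1)) * c
          * ((t ^ a)⁻¹ * exp (-(δ * t / L ^ m))) := by gcongr
    _ = c * ((a + 1).factorial / (δ * (1 - L⁻¹)) ^ (a + 1) / (L - 1)) * ((t ^ a)⁻¹ * exp (-(δ * t / L ^ m))) := by
        ring

/-! ## §3 MS-3 core: the window tail of the scale series -/

/-- [folklore] The pure scale series: `Σ_i (L^{m+i})^{−a} = (L^m)^{−a} ∕ (1 − (L^a)⁻¹)` for `L > 1`, `1 ≤ a`. -/
theorem hasSum_scale_window {L : ℝ} (hL : 1 < L) {a : ℕ} (ha : 1 ≤ a) (m : ℕ) :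
    HasSum (fun i : ℕ => ((L ^ (m + i)) ^ a)⁻¹) (((L ^ m) ^ a)⁻¹ * (1 - (L ^ a)⁻¹)⁻¹) := by
  have hL0 : 0 < L := by linarith
  have hq0 : 0 ≤ (L ^ a)⁻¹ := by positivity
  have hq1 : (L ^ a)⁻¹ < 1 := inv_lt_one_of_one_lt₀ (one_lt_pow₀ hL (by omega))
  have h := (hasSum_geometric_of_lt_one hq0 hq1).mul_left (((L ^ m) ^ a)⁻¹)
  refine h.congr_fun fun i => ?_
  show ((L ^ (m + i)) ^ a)⁻¹ = ((L ^ m) ^ a)⁻¹ * (L ^ a)⁻¹ ^ i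
  rw [pow_add, mul_pow, mul_inv, inv_pow, ← pow_mul L i a, ← pow_mul L a i, Nat.mul_comm i a]

/-- [our object] **MS-3 CORE.**  For `L > 1`, `1 ≤ a` and a real sequence with `|u k| ≤ A·(L^k)^{−a}` for every `k`: each tail is summable and
`|Σ_i u (m + i)| ≤ (A ∕ (1 − (L^a)⁻¹)) · (L^m)^{−a}` — the `D ∕ n^a` window shape with an `m`-FREE amplitude. -/
theorem tsum_scale_window_le {L A : ℝ} (hL : 1 < L) {a : ℕ} (ha : 1 ≤ a) {u : ℕ → ℝ}
    (hu : ∀ k : ℕ, |u k| ≤ A * ((L ^ k) ^ a)⁻¹) (m : ℕ) :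
    Summable (fun i : ℕ => u (m + i)) ∧ |∑' i : ℕ, u (m + i)| ≤ A / (1 - (L ^ a)⁻¹) * ((L ^ m) ^ a)⁻¹ := by
  have hmaj := (hasSum_scale_window hL ha m).mul_left A
  have hbound : ∀ i : ℕ, ‖u (m + i)‖ ≤ A * ((L ^ (m + i)) ^ a)⁻¹ := fun i => by
    rw [Real.norm_eq_abs]; exact hu (m + i)
  have hsum : Summable (fun i : ℕ => u (m + i)) := .of_norm_bounded hmaj.summable hbound
  refine ⟨hsum, ?_⟩
  have h := tsum_of_norm_bounded hmaj hbound
  rw [Real.norm_eq_abs] at h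
  calc |∑' i : ℕ, u (m + i)| ≤ A * (((L ^ m) ^ a)⁻¹ * (1 - (L ^ a)⁻¹)⁻¹) := h
    _ = A / (1 - (L ^ a)⁻¹) * ((L ^ m) ^ a)⁻¹ := by rw [div_eq_mul_inv]; ring

end Summit.QuantumFields.BalabanUV.Beta.FP.ScaleSeriesBounds
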